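import Summits.HubbardSuperconductivity.HubbardSuperconductivity.Theorems.JosephsonMirrorJmInterchangeZepoGivesHyp

/-!
# Route `JosephsonMirror` — crux `JmInterchange` (stmt-HubbardSuperconductivity-2227), line `Sketch`:
# the promoted residual (R1) is NECESSARY

`floorOrder_of_zeroExcessPairOrder_of_jmInterchange`: the crux `JmInterchange` itself implies the line's open stub
(R1) "zero-excess `d`-wave pair order reaches the ground floor" at every `(U, δ)`: zero-excess pair order gives the
uniform Josephson gain (`zepoGivesHyp`), the crux turns the gain into a ground-floor pair bridge `|⟨χ, Δ_d φ⟩|² ≥ a'L⁴`,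
and Cauchy–Schwarz with `‖χ‖ = 1` gives `‖Δ_d φ‖² ≥ a'L⁴` for the unit ground state `φ` of `(N_L, 0)`.  Hence
promoting (R1) to an item loses nothing: (R1) is sandwiched between the crux and (crux minus the window input (R2)),
cf. `jmInterchange_of_floorOrder_of_windowInputs` (Theorems/JosephsonMirrorJmInterchangeNormalForm.lean).

Sources: T. Koma, H. Tasaki, J. Stat. Phys. 76 (1994) 745.  Pure logic plus Cauchy–Schwarz; no new definitions.
-/

-- the mandated namespace `Summit.<Summit>.<Problem>.Theorems` repeats `HubbardSuperconductivity`
-- (single-problem summit, D-0017), which the `dupNamespace` linter flags on every declaration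
set_option linter.dupNamespace false

namespace Summit.HubbardSuperconductivity.HubbardSuperconductivity.Theorems.JosephsonMirror

open Matrix Literature.MathematicalPhysics.QuantumLattice Filter
open Summit.HubbardSuperconductivity.HubbardSuperconductivity.Theses.JosephsonMirror (JmInterchange)
open scoped Kronecker ComplexOrder

/-- **The crux implies its promoted residual (R1).**  If `JmInterchange` holds then, at every `U > 0`,
`δ ∈ (0, 1/2)`, ZERO-EXCESS PAIR ORDER (some `c > 0` such that for every `ε > 0`, eventually in even `L`, a unit
vector of sector `N_L` or `N_L − 2` (`S^z = 0`) lies within `εL²` of its sector floor and has `‖Δ_d v‖² ≥ cL⁴`)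
implies GROUND-FLOOR ORDER (some `c' > 0` such that eventually in even `L` some unit ground state `g` of `(N_L, 0)`
has `‖Δ_d g‖² ≥ c'L⁴`): `zepoGivesHyp` + the crux + `|⟨χ, Δ_d φ⟩|² ≤ ‖χ‖² ‖Δ_d φ‖²`.  Koma–Tasaki (1994). [folklore] -/
theorem floorOrder_of_zeroExcessPairOrder_of_jmInterchange :
    JmInterchange → ∀ (U δ : ℝ), 0 < U → δ ∈ Set.Ioo (0:ℝ) (1 / 2) →
      (∃ c : ℝ, 0 < c ∧ ∀ ε : ℝ, 0 < ε → ∃ L₀ : ℕ, ∀ (L : ℕ) [NeZero L], Even L → L₀ ≤ L →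
          ∃ n : ℕ, (n = (2 * ⌊(1 - δ) * (L : ℝ) ^ 2 / 2⌋₊) ∨ n = (2 * ⌊(1 - δ) * (L : ℝ) ^ 2 / 2⌋₊) - 2) ∧
            ∃ v : Fock (Orb (FermionTorus 2 L)), v ∈ szSector n 0 ∧ star v ⬝ᵥ v = 1 ∧
              (star v ⬝ᵥ (hubbardTorus 2 L 1 U *ᵥ v)).re ≤
                  (hubbardTorus 2 L 1 U).minEnergyOn (szSector n 0) + ε * (L : ℝ) ^ 2 ∧
              c * (L : ℝ) ^ 4 ≤
                (star (pairField dWaveFormFactor L *ᵥ v) ⬝ᵥ (pairField dWaveFormFactor L *ᵥ v)).re) →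
      ∃ c : ℝ, 0 < c ∧ ∃ L₀ : ℕ, ∀ (L : ℕ) [NeZero L], Even L → L₀ ≤ L →
          ∃ g : Fock (Orb (FermionTorus 2 L)), IsGroundStateInSector (hubbardTorus 2 L 1 U) (2 * ⌊(1 - δ) * (L : ℝ) ^ 2 / 2⌋₊) 0 g ∧
            star g ⬝ᵥ g = 1 ∧
            c * (L : ℝ) ^ 4 ≤
              (star (pairField dWaveFormFactor L *ᵥ g) ⬝ᵥ (pairField dWaveFormFactor L *ᵥ g)).re := by
  intro hJ U δ hU hδ hZ
  obtain ⟨a, J₀, ha, hJ₀, hG⟩ := zepoGivesHyp U δ hU hδ hZ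
  unfold JmInterchange at hJ
  obtain ⟨a', ha', L₀, hL₀⟩ := hJ U δ a J₀ hU hδ ha hJ₀ hG
  refine ⟨a', ha', L₀, fun L _ hE hL => ?_⟩
  obtain ⟨φ, χ, hφ, hφ1, -, hχ1, hbr⟩ := hL₀ L hE hL
  refine ⟨φ, hφ, hφ1, hbr.trans ?_⟩
  -- Cauchy–Schwarz with the unit vector `χ`: `‖⟨χ, Δφ⟩‖² ≤ ‖Δφ‖² = Re⟨Δφ, Δφ⟩`
  have hcs := norm_star_dotProduct_le_eucNorm hχ1 (pairField dWaveFormFactor L *ᵥ φ)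
  have h0 : 0 ≤ ‖star χ ⬝ᵥ pairField dWaveFormFactor L *ᵥ φ‖ := norm_nonneg _
  calc ‖star χ ⬝ᵥ pairField dWaveFormFactor L *ᵥ φ‖ ^ 2
      ≤ eucNorm (pairField dWaveFormFactor L *ᵥ φ) ^ 2 := pow_le_pow_left₀ h0 hcs 2
    _ = (star (pairField dWaveFormFactor L *ᵥ φ) ⬝ᵥ (pairField dWaveFormFactor L *ᵥ φ)).re := eucNorm_sq _

end Summit.HubbardSuperconductivity.HubbardSuperconductivity.Theorems.JosephsonMirror
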